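import Literature.AnabelianGeometry.SemiGraphs.PSCSmoothProperShape
import HarnessLib

/-!
# The [CombGC] §1 / [IUTchI] Rmk. 1.2.3 fact family holds at every origin of smooth-proper-shaped data

Mochizuki, *A combinatorial version of the Grothendieck conjecture* [CombGC] §1 pp. 8–14, and
*Inter-universal Teichmüller theory I* [IUTchI] Rmk. 1.2.3 pp. 41–43.  The printed statements typed
in `PSCGraphicity.lean` / `PSCRamification.lean` (abc-iut-L3-t4) are SCHEMATA `…Holds Ω` over the
origin parameter `Ω : PSCOrigin` ("`G` is of pro-Σ PSC-type", Def. 1.1 (i); never constructed in the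
tree — abc-iut FACT-LIST rows F-0438, F-0440, F-0443, F-0444, F-0458, F-0459, F-0461, F-0466, F-1931,
F-1937).  PROOF-ONLY file: building on `PSCSmoothProperShape.lean`, (1) Rmk. 1.4.3 (auxiliary
coverings) and [IUTchI] Rmk. 1.2.3 (iv) (cuspidal half), (v) hold for every datum of smooth-proper
shape (one vertex, no edges, `Π_v = Π`) over every topological group
(`auxiliaryCoveringsExist_of_smoothProper`, `cuspidalEdgeLikeCharacterization_of_isEmpty`,
`nodalEdgeLikeCharacterization_of_isEmpty` — the last uses `[⟨a⟩·U, ⟨a⟩·U] ≤ U`); (2) INSTANCE FORMS: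
every origin `Ω` all of whose data are of smooth-proper shape satisfies the ten rows above
(`commensurableTerminalityHolds_of_smoothProper`, …, `nodalEdgeLikeCharacterizationHolds_of_smoothProper`).
Such origins are inhabited by the genuine datum of a smooth proper genus-2 curve (companion
`PSCUnrVerticialOneVertex.lean`, which also shows that the ELEVENTH row of the family, F-1938
`UnrVerticialCharacterizationHolds`, FAILS at one vertex).  Joint satisfiability of the typed family with
a non-empty origin is consistency evidence, not the printed theorems (FACT policy: assumption labels).
[cite: MochizukiCombGC2007, §1 pp.8-14]  Nothing here takes a side on [IUTchIII] Cor. 3.12.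
-/

noncomputable section

namespace Literature.AnabelianGeometry.SemiGraphs

namespace PSCDatum

open scoped Pointwise

universe u

variable {P : Type u} [Group P] [TopologicalSpace P] [IsTopologicalGroup P]

/-! ### Rmk. 1.4.3 and [IUTchI] Rmk. 1.2.3 (iv)(v) at the smooth-proper shape -/

section Ramification

variable (G : PSCDatum P)

/-- No edges ⇒ `edgeFil U = closure [U, U]` (private copy of the lemma of
`PSCNodeExistenceTransferProofs.lean`, to keep this file's imports light).
[cite: MochizukiCombGC2007, Def 1.1(ii) p.7] -/
private theorem edgeFil_eq_closure_commutator' [IsEmpty G.graph.N] [IsEmpty G.graph.C] (U : Subgroup P) :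
    G.edgeFil U = (⁅U, U⁆ : Subgroup P).topologicalClosure := by
  haveI : IsEmpty {A : Subgroup P // G.IsEdgeLikeIn U A} :=
    ⟨fun A => by obtain ⟨B, hB, -⟩ := A.2; exact G.not_isEdgeLike_of_isEmpty B hB⟩
  unfold edgeFil
  rw [iSup_of_empty, sup_bot_eq]

omit [IsTopologicalGroup P] in
/-- `Π` is open. [folklore] -/
private theorem isOpen_top : IsOpen ((⊤ : Subgroup P) : Set P) := by
  rw [Subgroup.coe_top]; exact isOpen_univ

/-- **Rmk. 1.4.3** at the smooth-proper shape: the cuspidal and nodal cases are vacuous; in the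
verticial case `G'' := G` works (one vertex, `Π_v = Π`). [cite: MochizukiCombGC2007, Rmk 1.4.3 p.12] -/
theorem auxiliaryCoveringsExist_of_smoothProper [IsEmpty G.graph.N] [IsEmpty G.graph.C]
    (hV : ∀ v, G.vertGp v = ⊤) (v₀ : G.graph.V) (hv : ∀ w, w = v₀) :
    G.CuspidalAuxiliaryCoveringExists ∧ G.NodalAuxiliaryCoveringExists ∧
      G.VerticialAuxiliaryCoveringExists := by
  refine ⟨fun _ _ _ c => isEmptyElim c, fun _ _ _ e => isEmptyElim e,
    fun _ l k H' v γ _ hN hO _ _ _ => ⟨⊤, isOpen_top, le_top, le_top, ?_⟩⟩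
  refine ⟨?_, v, γ, ?_, fun v' γ' h => ?_⟩
  · rw [top_inf_eq]; exact isGaloisCovering_top hO
  · rw [hV, conjAct_smul_top, top_inf_eq, top_sup_eq]
  · exact (h.elim (fun hne => hne (by rw [hv v, hv v']))
      (fun hmem => hmem (mem_doubleCoset_top _ _ _))).elim

/-- **[IUTchI] Rmk. 1.2.3 (iv), cuspidal half**, with no cusps: no subgroup is cuspidal, and none
satisfies the ramification condition (test it at the characteristic open subgroup `Π` itself).
[cite: Mochizuki2012, IUTchI Rmk 1.2.3(iv) pp.41-42] -/
theorem cuspidalEdgeLikeCharacterization_of_isEmpty [IsEmpty G.graph.C] :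
    G.CuspidalEdgeLikeCharacterization := by
  intro l _
  dsimp only
  intro A
  refine ⟨fun h => absurd h (G.not_isCuspidal_of_isEmpty A), fun h => ?_⟩
  obtain ⟨⟨-, -, -, h4⟩, -⟩ := h
  obtain ⟨-, c, -⟩ := h4 ⊤ inferInstance isOpen_top
  exact isEmptyElim c

omit [TopologicalSpace P] [IsTopologicalGroup P] in
/-- In a cyclic-over-`U` situation the commutator subgroup dies in `U`: for `U ⊴ Π` and any `a`,
`[⟨a⟩·U, ⟨a⟩·U] ≤ U`. [folklore] -/
private theorem commutator_zpowers_sup_le (a : P) (U : Subgroup P) [U.Normal] :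
    ⁅Subgroup.zpowers a ⊔ U, Subgroup.zpowers a ⊔ U⁆ ≤ U := by
  have hK : (Subgroup.zpowers a ⊔ U).map (QuotientGroup.mk' U) =
      Subgroup.zpowers (QuotientGroup.mk' U a) := by
    rw [Subgroup.map_sup, MonoidHom.map_zpowers, (Subgroup.map_eq_bot_iff (H := U)).mpr
      (by rw [QuotientGroup.ker_mk']), sup_bot_eq]
  have hmem : ∀ g ∈ Subgroup.zpowers a ⊔ U, ∃ m : ℤ, (QuotientGroup.mk' U a) ^ m = QuotientGroup.mk' U g :=
    fun g hg => Subgroup.mem_zpowers_iff.mp (hK ▸ Subgroup.mem_map_of_mem _ hg)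
  refine Subgroup.commutator_le.mpr fun g₁ h₁ g₂ h₂ => ?_
  obtain ⟨m, hm⟩ := hmem g₁ h₁
  obtain ⟨n, hn⟩ := hmem g₂ h₂
  rw [← QuotientGroup.ker_mk' U, MonoidHom.mem_ker, map_commutatorElement, ← hm, ← hn]
  exact commutatorElement_eq_one_iff_mul_comm.mpr (zpow_mul_comm _ m n)

/-- **[IUTchI] Rmk. 1.2.3 (v)** at the smooth-proper shape (noncuspidal, no nodes): no subgroup is
nodal and none satisfies the ramification condition; and for closed procyclic `A ⊄ U`, `U`
characteristic open, the covering `U ⊆ A·U` is neither nodally totally ramified (no nodes) nor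
module-wise nodal (`M^edge = 0`, while `A·U ≠ U`). [cite: Mochizuki2012, IUTchI Rmk 1.2.3(v) p.43] -/
theorem nodalEdgeLikeCharacterization_of_isEmpty [IsEmpty G.graph.N] [IsEmpty G.graph.C] :
    G.NodalEdgeLikeCharacterization := by
  intro _ l _
  dsimp only
  refine ⟨fun A => ⟨fun h => absurd h (G.not_isNodal_of_isEmpty A), fun h => ?_⟩,
    fun A U _ ha _ hchar hUo _ hAU => ⟨?_, fun hmod => ?_⟩⟩
  · obtain ⟨⟨-, -, -, h4⟩, -⟩ := h
    obtain ⟨-, e, -⟩ := h4 ⊤ inferInstance isOpen_top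
    exact isEmptyElim e
  · rintro ⟨-, e, -⟩; exact isEmptyElim e
  · obtain ⟨a, rfl⟩ := ha
    obtain ⟨-, -, -, -, hsup⟩ := hmod
    exfalso
    apply hAU
    -- `edgeFil (A·U) = closure [A·U, A·U] ≤ U`
    set K : Subgroup P := Subgroup.zpowers a ⊔ U with hKdef
    have hKo : IsOpen (K : Set P) := Subgroup.isOpen_mono le_sup_right hUo
    have hAK : (Subgroup.zpowers a).topologicalClosure ≤ K :=
      Subgroup.topologicalClosure_minimal _ le_sup_left (K.isClosed_of_isOpen hKo)
    have hHK : (Subgroup.zpowers a).topologicalClosure ⊔ U ≤ K := sup_le hAK le_sup_right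
    have hE : G.edgeFil ((Subgroup.zpowers a).topologicalClosure ⊔ U) ≤ U := by
      rw [G.edgeFil_eq_closure_commutator']
      refine Subgroup.topologicalClosure_minimal _ ?_ (U.isClosed_of_isOpen hUo)
      exact (Subgroup.commutator_mono hHK hHK).trans (commutator_zpowers_sup_le a U)
    rw [sup_eq_left.mpr hE] at hsup
    exact le_sup_left.trans hsup.ge

end Ramification

/-! ### The instance forms: every origin of smooth-proper-shaped data satisfies the nine rows -/

section Origin

variable (Ω : PSCOrigin.{u})

/-- **F-0438 / Prop. 1.2 (ii)** at every origin whose data are of smooth-proper shape.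
[cite: MochizukiCombGC2007, Prop 1.2(ii) p.8] -/
theorem commensurableTerminalityHolds_of_smoothProper
    (hΩ : ∀ ⦃Q : Type u⦄ [Group Q] [TopologicalSpace Q] (G : PSCDatum Q), Ω.IsOfPSCType G →
      IsEmpty G.graph.N ∧ IsEmpty G.graph.C ∧ (∀ v, G.vertGp v = ⊤) ∧ ∃ v₀ : G.graph.V, ∀ w, w = v₀) :
    CommensurableTerminalityHolds Ω := by
  intro Q _ _ _ G hG
  obtain ⟨_, _, hV, v₀, -⟩ := hΩ G hG
  exact G.commensurablyTerminal_of_smoothProper hV v₀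

/-- **F-0459 / Prop. 1.2 (i)** at every origin of smooth-proper-shaped data.
[cite: MochizukiCombGC2007, Prop 1.2(i) p.8] -/
theorem openInterDeterminesComponentHolds_of_smoothProper
    (hΩ : ∀ ⦃Q : Type u⦄ [Group Q] [TopologicalSpace Q] (G : PSCDatum Q), Ω.IsOfPSCType G →
      IsEmpty G.graph.N ∧ IsEmpty G.graph.C ∧ (∀ v, G.vertGp v = ⊤) ∧ ∃ v₀ : G.graph.V, ∀ w, w = v₀) :
    OpenInterDeterminesComponentHolds Ω := by
  intro Q _ _ _ G hG
  obtain ⟨_, _, -, v₀, hv⟩ := hΩ G hG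
  exact ⟨G.verticialOpenInterDeterminesVertex_of_subsingleton v₀ hv,
    G.edgeLikeOpenInterDeterminesEdge_of_isEmpty, G.unrVerticialOpenInterDeterminesVertex_of_subsingleton v₀ hv⟩

/-- **F-0440 / Prop. 1.5 (i)** at every origin of smooth-proper-shaped data.
[cite: MochizukiCombGC2007, Prop 1.5(i) p.12] -/
theorem edgeLikeIncidenceHolds_of_smoothProper
    (hΩ : ∀ ⦃Q : Type u⦄ [Group Q] [TopologicalSpace Q] (G : PSCDatum Q), Ω.IsOfPSCType G →
      IsEmpty G.graph.N ∧ IsEmpty G.graph.C ∧ (∀ v, G.vertGp v = ⊤) ∧ ∃ v₀ : G.graph.V, ∀ w, w = v₀) :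
    EdgeLikeIncidenceHolds Ω := by
  intro Q _ _ G hG
  obtain ⟨_, _, -, -⟩ := hΩ G hG
  exact G.edgeLikeIncidence_of_isEmpty

/-- **F-0443 / Prop. 1.5 (ii)** at every origin of smooth-proper-shaped data.
[cite: MochizukiCombGC2007, Prop 1.5(ii) p.13] -/
theorem graphicIffEdgeLikeVerticialHolds_of_smoothProper
    (hΩ : ∀ ⦃Q : Type u⦄ [Group Q] [TopologicalSpace Q] (G : PSCDatum Q), Ω.IsOfPSCType G →
      IsEmpty G.graph.N ∧ IsEmpty G.graph.C ∧ (∀ v, G.vertGp v = ⊤) ∧ ∃ v₀ : G.graph.V, ∀ w, w = v₀) :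
    GraphicIffEdgeLikeVerticialHolds Ω := by
  intro Q _ _ _ Q' _ _ _ G H α hG hH
  obtain ⟨_, _, hV, v₀, hv⟩ := hΩ G hG
  obtain ⟨_, _, hW, w₀, hw⟩ := hΩ H hH
  exact G.graphicIffEdgeLikeVerticial_of_smoothProper H hV v₀ hv hW w₀ hw α

/-- **F-0458 / Thm. 1.6 (i)** at every origin of smooth-proper-shaped data.
[cite: MochizukiCombGC2007, Thm 1.6(i) p.13] -/
theorem numericallyCuspidalIffHolds_of_smoothProper
    (hΩ : ∀ ⦃Q : Type u⦄ [Group Q] [TopologicalSpace Q] (G : PSCDatum Q), Ω.IsOfPSCType G →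
      IsEmpty G.graph.N ∧ IsEmpty G.graph.C ∧ (∀ v, G.vertGp v = ⊤) ∧ ∃ v₀ : G.graph.V, ∀ w, w = v₀) :
    NumericallyCuspidalIffHolds Ω := by
  intro Q _ _ _ Q' _ _ _ G H α hG hH
  obtain ⟨_, _, -, -⟩ := hΩ G hG
  obtain ⟨_, _, -, -⟩ := hΩ H hH
  exact G.numericallyCuspidalIff_of_isEmpty H α

/-- **F-0444 / Thm. 1.6 (ii)** at every origin of smooth-proper-shaped data.
[cite: MochizukiCombGC2007, Thm 1.6(ii) p.13] -/
theorem graphicIffFiltrationPreservingHolds_of_smoothProper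
    (hΩ : ∀ ⦃Q : Type u⦄ [Group Q] [TopologicalSpace Q] (G : PSCDatum Q), Ω.IsOfPSCType G →
      IsEmpty G.graph.N ∧ IsEmpty G.graph.C ∧ (∀ v, G.vertGp v = ⊤) ∧ ∃ v₀ : G.graph.V, ∀ w, w = v₀) :
    GraphicIffFiltrationPreservingHolds Ω := by
  intro Q _ _ _ Q' _ _ _ G H α hG hH
  obtain ⟨_, _, hV, v₀, hv⟩ := hΩ G hG
  obtain ⟨_, _, hW, w₀, hw⟩ := hΩ H hH
  exact G.graphicIffGraphicallyFiltrationPreserving_of_smoothProper H hV v₀ hv hW w₀ hw α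

/-- **F-0461 / Thm. 1.6 (iii)** at every origin of smooth-proper-shaped data.
[cite: MochizukiCombGC2007, Thm 1.6(iii) p.13] -/
theorem unrVerticialIffHolds_of_smoothProper
    (hΩ : ∀ ⦃Q : Type u⦄ [Group Q] [TopologicalSpace Q] (G : PSCDatum Q), Ω.IsOfPSCType G →
      IsEmpty G.graph.N ∧ IsEmpty G.graph.C ∧ (∀ v, G.vertGp v = ⊤) ∧ ∃ v₀ : G.graph.V, ∀ w, w = v₀) :
    UnrVerticialIffHolds Ω := by
  intro Q _ _ _ Q' _ _ _ G H β hG hH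
  obtain ⟨_, _, hV, v₀, -⟩ := hΩ G hG
  obtain ⟨_, _, hW, w₀, -⟩ := hΩ H hH
  exact G.unrVerticiallyFiltrationPreservingIffVerticial_of_smoothProper H hV v₀ hW w₀ β

/-- **F-0466 / Rmk. 1.4.3** at every origin of smooth-proper-shaped data.
[cite: MochizukiCombGC2007, Rmk 1.4.3 p.12] -/
theorem auxiliaryCoveringsExistHolds_of_smoothProper
    (hΩ : ∀ ⦃Q : Type u⦄ [Group Q] [TopologicalSpace Q] (G : PSCDatum Q), Ω.IsOfPSCType G →
      IsEmpty G.graph.N ∧ IsEmpty G.graph.C ∧ (∀ v, G.vertGp v = ⊤) ∧ ∃ v₀ : G.graph.V, ∀ w, w = v₀) :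
    AuxiliaryCoveringsExistHolds Ω := by
  intro Q _ _ _ G hG
  obtain ⟨_, _, hV, v₀, hv⟩ := hΩ G hG
  exact G.auxiliaryCoveringsExist_of_smoothProper hV v₀ hv

/-- **F-1931 / [IUTchI] Rmk. 1.2.3 (iv) (cuspidal)** at every origin of smooth-proper-shaped data.
[cite: Mochizuki2012, IUTchI Rmk 1.2.3(iv) pp.41-42] -/
theorem cuspidalEdgeLikeCharacterizationHolds_of_smoothProper
    (hΩ : ∀ ⦃Q : Type u⦄ [Group Q] [TopologicalSpace Q] (G : PSCDatum Q), Ω.IsOfPSCType G →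
      IsEmpty G.graph.N ∧ IsEmpty G.graph.C ∧ (∀ v, G.vertGp v = ⊤) ∧ ∃ v₀ : G.graph.V, ∀ w, w = v₀) :
    CuspidalEdgeLikeCharacterizationHolds Ω := by
  intro Q _ _ _ G hG
  obtain ⟨_, _, -, -⟩ := hΩ G hG
  exact G.cuspidalEdgeLikeCharacterization_of_isEmpty

/-- **F-1937 / [IUTchI] Rmk. 1.2.3 (v)** at every origin of smooth-proper-shaped data.
[cite: Mochizuki2012, IUTchI Rmk 1.2.3(v) p.43] -/
theorem nodalEdgeLikeCharacterizationHolds_of_smoothProper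
    (hΩ : ∀ ⦃Q : Type u⦄ [Group Q] [TopologicalSpace Q] (G : PSCDatum Q), Ω.IsOfPSCType G →
      IsEmpty G.graph.N ∧ IsEmpty G.graph.C ∧ (∀ v, G.vertGp v = ⊤) ∧ ∃ v₀ : G.graph.V, ∀ w, w = v₀) :
    NodalEdgeLikeCharacterizationHolds Ω := by
  intro Q _ _ _ G hG
  obtain ⟨_, _, -, -⟩ := hΩ G hG
  exact G.nodalEdgeLikeCharacterization_of_isEmpty

end Origin

end PSCDatum

end Literature.AnabelianGeometry.SemiGraphs

end
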